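import Mathlib
import Summits.RiemannHypothesis.RiemannHypothesis.Theorems.WeilGroundStateArchimedeanWindowSimpleEvenTrial3
import Summits.RiemannHypothesis.RiemannHypothesis.Theorems.WeilGroundStateGroundStateSimpleEvenStubParabolaEnergy
import HarnessLib

/-!
# `EvenWinsArch` — the energy of the rescaled parabolic bump

Stub `stub_bumpEnergy` (T4) of the line `registered` (birth) of the crux `EvenWinsArch`
(route `RiemannHypothesis/WeilParity`, item stmt-RiemannHypothesis-15433).

For `0 < r ≤ 1/3` the rescaled tree bump `f_r(x) = trialFun (x/(3r)) = (1 − x²/r²)⁺` (supported in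
`[-r, r]`) has finite archimedean energy and

  `𝓔_r(f_r) ≤ (248/225) r + (28/45) r² + (32/15) r · T(2r)`,  `T(x) = ∫_{Ioi x} ρ`,

`ρ(t) = weilArchDensity t = e^{t/2}/(2 sinh t)`, `D_t = weilIncrement`. Proof: no prime enters the window
(`n ∈ weilPrimeIndex r ⇒ log n < 2r ≤ 2/3 < log 2 ⇒ n ≤ 1 ⇒ Λ(n) = 0`), so
`𝓔_r(f_r) = ∫_{Ioi 0} ρ D_t(f_r) = ∫_{Ioc 0 (2r)} ρ D_t(f_r) + ∫_{Ioi (2r)} ρ D_t(f_r)`; the bulk is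
`≤ r (248/225 + 28r/45)` and `D_t(f_r) = 32r/15` on `t ≥ 2r` — both are the tree's parabolic-bump facts
(`stub_parabolaIncrementEnergy`, file `WeilGroundStateGroundStateSimpleEvenStubParabolaEnergy`, where the
bump is written `(1 − (x/b)²)⁺ = trialFun (x/(3b))`, `par_bump_eq`).
-/

namespace Summit.RiemannHypothesis.RiemannHypothesis.Theorems.WeilParity.EvenWinsArch

open Set MeasureTheory Filter
open Literature.NumberTheory.LFunctions
open Summit.RiemannHypothesis.RiemannHypothesis.Theorems.WeilGroundState
open Summit.RiemannHypothesis.RiemannHypothesis.Theorems.GroundStateSimpleEven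

set_option linter.dupNamespace false in
/-- The rescaled tree bump is the parabolic bump: `trialFun (x/(3r)) = (1 − (x/r)²)⁺`. [folklore] -/
theorem bumpEnergy_funext (r : ℝ) :
    (fun x : ℝ ↦ trialFun (x / (3 * r))) = fun x : ℝ ↦ (((max (1 - (x / r) ^ 2) 0 : ℝ)) : ℂ) :=
  funext fun x ↦ (par_bump_eq r x).symm

set_option linter.dupNamespace false in
/-- No prime power enters a window `r ≤ 1/3`: `Λ(n) = 0` for `n ∈ weilPrimeIndex r`
(`log n < 2r ≤ 2/3 < log 2` forces `n ≤ 1`). [folklore] -/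
theorem bumpEnergy_vonMangoldt_eq_zero {r : ℝ} (hr : r ≤ 1 / 3) {n : ℕ}
    (hn : n ∈ weilPrimeIndex r) : (ArithmeticFunction.vonMangoldt n : ℝ) = 0 := by
  rw [mem_weilPrimeIndex] at hn
  rcases Nat.lt_or_ge n 2 with h2 | h2
  · interval_cases n <;> simp
  · exfalso
    have hlog : Real.log 2 ≤ Real.log n := Real.log_le_log two_pos (by exact_mod_cast h2)
    have := Real.log_two_gt_d9
    linarith

set_option linter.dupNamespace false in
/-- **The energy of the rescaled bump.** For `0 < r ≤ 1/3`, `t ↦ ρ(t) D_t(f_r)` is integrable on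
`(0, ∞)` for `f_r(x) = trialFun (x/(3r))` and
`𝓔_r(f_r) ≤ (248/225) r + (28/45) r² + (32/15) r ∫_{Ioi (2r)} ρ`. [folklore] -/
theorem stub_bumpEnergy :
    ∀ r : ℝ, 0 < r → r ≤ 1 / 3 →
      MeasureTheory.IntegrableOn
          (fun t : ℝ ↦ Literature.NumberTheory.LFunctions.weilArchDensity t *
            Literature.NumberTheory.LFunctions.weilIncrement
              (fun x : ℝ ↦ Summit.RiemannHypothesis.RiemannHypothesis.Theorems.WeilGroundState.trialFun
                (x / (3 * r))) t) (Set.Ioi 0) ∧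
        Literature.NumberTheory.LFunctions.weilDirichletEnergy r
            (fun x : ℝ ↦ Summit.RiemannHypothesis.RiemannHypothesis.Theorems.WeilGroundState.trialFun
              (x / (3 * r))) ≤
          248 / 225 * r + 28 / 45 * r ^ 2 +
            32 / 15 * r * ∫ t in Set.Ioi (2 * r), Literature.NumberTheory.LFunctions.weilArchDensity t := by
  intro r hr hr3
  rw [bumpEnergy_funext r]
  obtain ⟨-, hge, hi, hb1⟩ := stub_parabolaIncrementEnergy r hr
  refine ⟨hi, ?_⟩
  have h2r : 0 < 2 * r := by positivity
  have hi1 : IntegrableOn (fun t : ℝ ↦ weilArchDensity t *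
      weilIncrement (fun x : ℝ ↦ (((max (1 - (x / r) ^ 2) 0 : ℝ)) : ℂ)) t) (Ioc 0 (2 * r)) :=
    hi.mono_set Ioc_subset_Ioi_self
  have hi2 : IntegrableOn (fun t : ℝ ↦ weilArchDensity t *
      weilIncrement (fun x : ℝ ↦ (((max (1 - (x / r) ^ 2) 0 : ℝ)) : ℂ)) t) (Ioi (2 * r)) :=
    hi.mono_set (Ioi_subset_Ioi h2r.le)
  have heq : EqOn (fun t : ℝ ↦ weilArchDensity t *
        weilIncrement (fun x : ℝ ↦ (((max (1 - (x / r) ^ 2) 0 : ℝ)) : ℂ)) t)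
      (fun t : ℝ ↦ 32 / 15 * r * weilArchDensity t) (Ioi (2 * r)) := by
    intro t ht
    have ht' : 2 * r < t := ht
    simp only
    rw [hge t ht'.le]
    ring
  unfold weilDirichletEnergy
  rw [Finset.sum_eq_zero fun n hn ↦ by rw [bumpEnergy_vonMangoldt_eq_zero hr3 hn]; simp, zero_add,
    ← Ioc_union_Ioi_eq_Ioi h2r.le, setIntegral_union Ioc_disjoint_Ioi_same measurableSet_Ioi hi1 hi2,
    setIntegral_congr_fun measurableSet_Ioi heq, integral_const_mul]
  linarith [hb1]

end Summit.RiemannHypothesis.RiemannHypothesis.Theorems.WeilParity.EvenWinsArch
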